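import Literature.NumberTheory.K2Lit.LocalDoublingSiegel
import Literature.NumberTheory.K2Lit.LocalSiegelIntertwining

/-!
# The unramified local section `Λ_{s,v}` IS a spherical section of `I_v(s, χ_v)` (existence half of O41.5 (4c))

Track B ∕ K2-LIT, hLiu418 = stmt-HodgeConjecture-24832. Helper (count-neutral): at a finite place `v` of `L⁺` above which the Hecke character `χ`
of `L` is unramified, the unramified local section ★ `LambdaLoc χ v s` of ★ `K2Lit/LocalDoublingSiegel` (D7c) satisfies ★ D10's predicate
`LocalSiegelDoubled.IsSphericalSection` (`K2Lit/LocalSiegelIntertwining`: Siegel section ∧ right `K_{H,v}`-invariant ∧ value `1` at `1`) for the local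
family `χ_w := χ.localComponent w` — so the EXISTENCE of the `K_{H,v}`-spherical vector of the degenerate principal series (organ O41.5 (4c) of the
#41 programme, and the section of the unramified computation of the s23 seam) is settled by name; uniqueness is ★ `IsSphericalSection.unique` under the
local Iwasawa decomposition ★ `K2LiuLocalSiegelIwasawa.exists_isSiegelDelta_mul_mem_localInt` (good places).

* `isSphericalSection_lambdaLoc` — the statement above (★ `lambdaLoc_mem_localDegPS`, ★ `lambdaLoc_mul_localInt`, ★ `lambdaLoc_one`).
* `exists_isSphericalSection` — ∃-form.

HONEST LABEL: HC_CM is proved only modulo the printed citations (2 remaining named inputs: hLiu418 = stmt-HodgeConjecture-24832, h413 =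
stmt-HodgeConjecture-24833) until rung 0 closes; this file is unconditional and moves no counter.
References: [Casselman1980, §3]; [Li1992, §3]; [GelbartPiatetskishapiroRallis1987, Part A §6]; [HarrisKudlaSweet1996, §1 (1.15)].
-/

set_option autoImplicit false

set_option linter.dupNamespace false

noncomputable section

open NumberField IsDedekindDomain

namespace Summit.HodgeConjecture.HodgeConjecture.Cruxes.HLiu418.K2LiuLocalSphericalSectionExists

open Literature.NumberTheory.Automorphic Literature.NumberTheory.GaloisRepresentations
open Literature.NumberTheory.GelbartRogawski1991 Literature.NumberTheory.GelbartRogawski1991.GRConstruction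
open Literature.NumberTheory.GelbartRogawski1991.UnitaryDualPair
open Literature.NumberTheory.K2Lit Literature.NumberTheory.K2Lit.SiegelDoubled

variable (L : Type) [Field L] [NumberField L] [IsCMField L]
variable {N M n : ℕ} (e : Fin N × Fin M ≃ Fin n)
  (dV : Fin N → L) (hdV : ∀ i, IsCMField.complexConj L (dV i) = dV i)
  (dW : Fin M → L) (hdW : ∀ i, IsCMField.complexConj L (dW i) = dW i)
  (v : HeightOneSpectrum (𝓞 (Fp L)))

/-- **`Λ_{s,v}` is a spherical section of `I_v(s, χ_v)`** (★ D10 `IsSphericalSection`) for `χ` unramified above `v`: Siegel section (from ★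
`lambdaLoc_mem_localDegPS`), right `K_{H,v}`-invariant (★ `lambdaLoc_mul_localInt`), `Λ_{s,v}(1) = 1` (★ `lambdaLoc_one`).
[cite: Casselman1980, §3] [cite: Li1992, §3] [cite: HarrisKudlaSweet1996, §1 (1.15)] -/
theorem isSphericalSection_lambdaLoc (χ : HeckeCharacter L) (s : ℂ)
    (hχ : ∀ w : UnitaryGroup.PlacesOver L v, χ.IsUnramifiedAt w.1) :
    haveI : Algebra.IsQuadraticExtension (Fp L) L := IsCMField.isQuadraticExtension L
    LocalSiegelDoubled.IsSphericalSection (Fp L) L (IsCMField.complexConj L) (complexConj_imagUnit L) (imagUnit_ne_zero L)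
      (imagUnit_mul_self L) v n (gramR_isSymm L e dV hdV dW hdW) (hermD_eq_map_gramD L e dV hdV dW hdW)
      (fun w => χ.localComponent w.1) s (LambdaLoc L e dV hdV dW hdW v χ s) := by
  haveI : Algebra.IsQuadraticExtension (Fp L) L := IsCMField.isQuadraticExtension L
  refine ⟨((LocalSiegelDoubled.mem_localDegPS_iff (Fp L) L (IsCMField.complexConj L) (complexConj_imagUnit L) (imagUnit_ne_zero L)
      (imagUnit_mul_self L) v n (gramR_isSymm L e dV hdV dW hdW) (hermD_eq_map_gramD L e dV hdV dW hdW) _ s _).1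
      (lambdaLoc_mem_localDegPS L e dV hdV dW hdW v χ s hχ)).1, fun k hk h => ?_, lambdaLoc_one L e dV hdV dW hdW v χ s hχ⟩
  exact lambdaLoc_mul_localInt L e dV hdV dW hdW v χ s hχ h hk

/-- ∃-form: **a spherical section of `I_v(s, χ_v)` EXISTS** at every finite place above which `χ` is unramified (witness `Λ_{s,v}`).
[cite: Casselman1980, §3] [cite: GelbartPiatetskishapiroRallis1987, Part A §6] -/
theorem exists_isSphericalSection (χ : HeckeCharacter L) (s : ℂ)
    (hχ : ∀ w : UnitaryGroup.PlacesOver L v, χ.IsUnramifiedAt w.1) :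
    haveI : Algebra.IsQuadraticExtension (Fp L) L := IsCMField.isQuadraticExtension L
    ∃ φ : UnitaryGroup.localPi L (IsCMField.complexConj L) (n + n) (hermD L e dV hdV dW hdW) v → ℂ,
      LocalSiegelDoubled.IsSphericalSection (Fp L) L (IsCMField.complexConj L) (complexConj_imagUnit L) (imagUnit_ne_zero L)
        (imagUnit_mul_self L) v n (gramR_isSymm L e dV hdV dW hdW) (hermD_eq_map_gramD L e dV hdV dW hdW)
        (fun w => χ.localComponent w.1) s φ :=
  ⟨LambdaLoc L e dV hdV dW hdW v χ s, isSphericalSection_lambdaLoc L e dV hdV dW hdW v χ s hχ⟩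

end Summit.HodgeConjecture.HodgeConjecture.Cruxes.HLiu418.K2LiuLocalSphericalSectionExists

end
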